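import Summits.Ventures.Crystal3D.Theorems.StickyWulffConstantTextureBuildTentZoneCells
import Summits.Ventures.Crystal3D.Theorems.StickyWulffConstantTextureBuildTentPerimeter
import HarnessLib

/-!
# TB-D assembly, part 19: (L-T) THE TENT ZONES ARE PAID BY THE TENT BUDGET — `stub_LT` of the blueprint TexShadowTB.lean, proved
# (lane T, crux `TextureLiminfV5`, stmt-Ventures-23912; blueprint HOME/wulff-p2/g20/TexShadowTB.lean)

HONEST FRAMING. Venture `Summits/Ventures/Crystal3D` (cell `crystal3d-full`), route `route-Ventures-StickyWulffConstant`, helper `--supports` the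
law-v5 crux `TextureLiminfV5` (stmt-Ventures-23912).  Proof (census-free, standard axioms) of the blueprint stub `TexInput.stub_LT` for EVERY texture input:
inside the open tent zone `U_f ∩ laySlab_f i` the union of the labelled cells IS the tent solid `G_f` up to a null set (…CellsLabels + the a.e. cover of
`refineCells`), so the localized perimeters agree (`perKIn_congr_of_open`, p716756) and the certificate pays (`TentCert.perKIn_ne_top`,
`TentCert.sum_perKIn_le_budget`, p716588).  F-C1 not moved.

(the identification `pieces_inter_zone_ae_eq` is in part 19a …TentZoneCells)
* `TexInput.perKIn_zone_eq` — `perKIn (W_c) (⋃ pieces) (zone c) = perKIn (W_c) G_f (U_f ∩ slab_f i)`;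
* **`TexInput.tent_zone_le`** — `(∀ c, perKIn … ≠ ⊤) ∧ Σ_c (perKIn …).toReal ≤ rc.tentBudget` (= `stub_LT`, with no hypothesis on the input).
-/

noncomputable section

open scoped BigOperators InnerProductSpace ENNReal

namespace Summit.Ventures.Crystal3D.Cruxes.TextureLiminf.TexShadow

open Summit.Ventures.Crystal3D Summit.Ventures.Crystal3D.Theorems MeasureTheory Set
open Summit.Ventures.Crystal3D.TentCertificate (isOpen_laySlab mem_laySlab_iff)

namespace TexInput

variable {C R₀ : ℝ} {N : ℕ} {x : Fin N → E3} {rc : RiseredCover C R₀ N x} {δ : ℝ} {μ : Mesh₅ rc δ} (I : TexInput rc μ)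

/-- **The localized perimeters agree**: `perKIn (W_c) (⋃ pieces) (zone c) = perKIn (W_c) G_f (U_f ∩ slab_f i)`. -/
theorem perKIn_zone_eq (c : Fin I.cells.n) (K : Set E3) :
    perKIn K (⋃ i, polytope (I.cells.Hp i)) (I.zone c) = perKIn K (I.ct (I.enc.symm c).1).G (I.zone c) :=
  perKIn_congr_of_open (I.isOpen_zone c) (I.pieces_inter_zone_ae_eq c)

/-- **(L-T) THE TENT ZONES ARE PAID BY THE TENT BUDGET** (`stub_LT` of the blueprint, for every input). -/
theorem tent_zone_le :
    (∀ c, perKIn (wulffOf (I.frameOf c)) (⋃ i, polytope (I.cells.Hp i)) (I.zone c) ≠ ⊤) ∧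
    (∑ c, (perKIn (wulffOf (I.frameOf c)) (⋃ i, polytope (I.cells.Hp i)) (I.zone c)).toReal) ≤ rc.tentBudget := by
  -- the zone term of class `c` is the certificate's slab term of `enc.symm c = (f, i)`
  have hterm : ∀ c : Fin I.cells.n, perKIn (wulffOf (I.frameOf c)) (⋃ i, polytope (I.cells.Hp i)) (I.zone c) =
      perKIn (wulffOf ((rc.tent (I.enc.symm c).1).frame (I.enc.symm c).2.1)) (I.ct (I.enc.symm c).1).G
        ((rc.tent (I.enc.symm c).1).U ∩ laySlab (rc.tent (I.enc.symm c).1).L (rc.tent (I.enc.symm c).1).s (I.enc.symm c).2.1) := by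
    intro c
    rw [perKIn_zone_eq]
    rfl
  refine ⟨fun c => ?_, ?_⟩
  · rw [hterm]
    exact (I.ct _).perKIn_ne_top _
  · set F : I.Class → ℝ := fun a =>
      (perKIn (wulffOf ((rc.tent a.1).frame a.2.1)) (I.ct a.1).G ((rc.tent a.1).U ∩ laySlab (rc.tent a.1).L (rc.tent a.1).s a.2.1)).toReal with hF
    have hsum : (∑ c, (perKIn (wulffOf (I.frameOf c)) (⋃ i, polytope (I.cells.Hp i)) (I.zone c)).toReal) = ∑ a : I.Class, F a := by
      rw [← Equiv.sum_comp I.enc.symm F]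
      exact Finset.sum_congr rfl fun c _ => by rw [hterm]
    rw [hsum, Fintype.sum_sigma]
    change ∑ f, ∑ i : {i : ℤ // i ∈ I.slabWindow f},
        (perKIn (wulffOf ((rc.tent f).frame i.1)) (I.ct f).G ((rc.tent f).U ∩ laySlab (rc.tent f).L (rc.tent f).s i.1)).toReal ≤
      ∑ f, (rc.tent f).budget
    refine Finset.sum_le_sum fun f _ => ?_
    rw [Finset.sum_coe_sort (I.slabWindow f)
      (fun i => (perKIn (wulffOf ((rc.tent f).frame i)) (I.ct f).G ((rc.tent f).U ∩ laySlab (rc.tent f).L (rc.tent f).s i)).toReal)]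
    exact (I.ct f).sum_perKIn_le_budget (I.slabWindow f)

end TexInput

end Summit.Ventures.Crystal3D.Cruxes.TextureLiminf.TexShadow

end
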